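import Literature.Computability.QuantumComplexity.ForrelationCompleteProofs
import HarnessLib

/-!
# `k`-fold Forrelation: idle coordinates and relabelling of coordinates

Topic `Literature/Computability/QuantumComplexity`; groundwork for the membership half
`AaronsonAmbainis2018_kForrelation_mem` of `aaronson_ambainis_kForrelation_complete`
(S. Aaronson, A. Ambainis, *Forrelation*, SIAM J. Comput. 47 (2018) = arXiv:1411.5729, §6, p. 26
with §3.2, Prop. 6). In the tree's promise problem `kForrelationProblem` (`Forrelation.lean`) the
arity `n` of an instance is written in *binary*, so an instance of code length `ℓ` may live on
`n ≫ ℓ` bits while its circuits read at most `ℓ` of them; a polynomial-size quantum circuit can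
only simulate the coordinates actually read. This file proves the two identities that justify
the reduction to the read coordinates:

* **relabelling** (`kForrelationValue_comp_equiv`): `Φ` is invariant under a simultaneous
  permutation of the coordinates of all `fᵢ` (the twisted sum is reindexed);
* **idle coordinates** (`kForrelationValue_idle`, `kForrelationValue_idle_pow`): if no `fᵢ`
  reads the last `t` coordinates, then `Φ_{f} = Φ_{g} · ρ_k^t` where `g` are the restrictions to
  the first `s` coordinates and `ρ_k = T_k / √(2^{k+1})` with `T_k = ∑_{b ∈ {0,1}^k} ∏_{i ≥ 1}
  (-1)^{b_{i-1} b_i} = 2^{⌈k/2⌉}` (`twistSum_eq`); so **`ρ_k = 1` for odd `k` and `ρ_k = 1/√2`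
  for even `k`** (`idleFactor_of_odd`, `idleFactor_of_even`) — an idle coordinate carries
  `k + 1` Hadamard gates in the circuit of AA Fig. 2, i.e. `H^{k+1} ∈ {1, H}`.

Consequently (odd `k`) idle coordinates may be discarded, and (even `k`) `14` idle coordinates
already force `|Φ| ≤ 2^{-7} < 3/5`.

## References

* S. Aaronson, A. Ambainis, *Forrelation: a problem that optimally separates quantum from
  classical computing*, SIAM J. Comput. 47 (2018) 982–1038; arXiv:1411.5729, §1.1.3 (definition
  of `Φ_{f₁,…,f_k}`), §3.2 (Fig. 2: `Φ` as the amplitude of `H^{⊗n} U_{f_k} ⋯ U_{f₁} H^{⊗n}`), §6 p. 26.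
-/

noncomputable section

namespace Literature.Computability.QuantumComplexity

open Finset

variable {k s n : ℕ}

/-! ### Relabelling the coordinates -/

/-- The twist is invariant under a simultaneous relabelling of the coordinates. [cite: AaronsonAmbainis2018, §1.1.3] -/
theorem twist_comp_equiv (σ : Fin n ≃ Fin n) (x y : Fin n → Bool) : twist (x ∘ σ) (y ∘ σ) = twist x y := by
  unfold twist
  exact Equiv.prod_comp σ (fun l => if x l && y l then (-1 : ℝ) else 1)

/-- The path weight of relabelled functions at a tuple is the path weight at the relabelled tuple.
[cite: AaronsonAmbainis2018, §1.1.3] -/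
theorem pathWeight_comp_equiv (σ : Fin n ≃ Fin n) (f : Fin k → (Fin n → Bool) → Bool) (x : Fin k → (Fin n → Bool)) :
    pathWeight (fun i y => f i (y ∘ σ)) x = pathWeight f (fun i => x i ∘ σ) := by
  unfold pathWeight
  refine Finset.prod_congr rfl fun i _ => ?_
  split_ifs with h
  · rfl
  · rw [twist_comp_equiv]

/-- **`Φ` is invariant under a simultaneous permutation of the coordinates** of all `fᵢ`.
[cite: AaronsonAmbainis2018, §1.1.3] -/
theorem kForrelationValue_comp_equiv (σ : Fin n ≃ Fin n) (f : Fin k → (Fin n → Bool) → Bool) :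
    kForrelationValue (fun i y => f i (y ∘ σ)) = kForrelationValue f := by
  rw [kForrelationValue_eq, kForrelationValue_eq]
  congr 1
  simp only [pathWeight_comp_equiv]
  let E : (Fin k → (Fin n → Bool)) ≃ (Fin k → (Fin n → Bool)) :=
    { toFun := fun x i => x i ∘ σ
      invFun := fun x i => x i ∘ σ.symm
      left_inv := fun x => by funext i l; simp
      right_inv := fun x => by funext i l; simp }
  exact Fintype.sum_equiv E _ _ fun x => rfl

/-! ### The weight of an idle coordinate -/

/-- Appending a coordinate multiplies the twist by the one-bit twist `(-1)^{ab} = signOf (a ∧ b)` of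
the appended bits. [cite: AaronsonAmbainis2018, §1.1.3] -/
theorem twist_snoc (x y : Fin s → Bool) (a b : Bool) :
    twist (Fin.snoc x a : Fin (s + 1) → Bool) (Fin.snoc y b) = twist x y * signOf (a && b) := by
  unfold twist signOf
  rw [Fin.prod_univ_castSucc]
  simp only [Fin.snoc_castSucc, Fin.snoc_last]

/-- The chain weight `∏_{0 < i < k} (-1)^{b_{i-1} b_i}` of the bits of one idle coordinate along the
`k` functions. [cite: AaronsonAmbainis2018, §1.1.3] -/
def chainWeight (b : Fin k → Bool) : ℝ :=
  ∏ i : Fin k, if h : (i : ℕ) = 0 then 1 else signOf (b ⟨(i : ℕ) - 1, by omega⟩ && b i)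

/-- `T_k = ∑_{b ∈ {0,1}^k} chainWeight b`, the total weight of an idle coordinate.
[cite: AaronsonAmbainis2018, §1.1.3] -/
def twistSum (k : ℕ) : ℝ := ∑ b : Fin k → Bool, chainWeight b

/-- **Factorisation of the path weight** when no function reads the last coordinate: the weight
of the tuple `(yᵢ bᵢ)ᵢ` is the weight of `(yᵢ)ᵢ` for the restrictions times the chain weight of
`(bᵢ)ᵢ`. [cite: AaronsonAmbainis2018, §1.1.3] -/
theorem pathWeight_idle (g : Fin k → (Fin s → Bool) → Bool) (y : Fin k → Fin s → Bool) (b : Fin k → Bool) :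
    pathWeight (n := s + 1) (fun i x => g i (fun j => x (Fin.castSucc j))) (fun i => Fin.snoc (y i) (b i)) =
      pathWeight g y * chainWeight b := by
  unfold pathWeight chainWeight
  rw [← Finset.prod_mul_distrib]
  refine Finset.prod_congr rfl fun i _ => ?_
  simp only [Fin.snoc_castSucc]
  split_ifs with h
  · simp
  · rw [twist_snoc]; ring

/-- Tuples of functions on `s + 1` coordinates are pairs (restrictions, last bits); the coordinatewise
version of Mathlib's `Fin.snocEquiv` (per function `(Fin (s+1) → Bool) ≃ Bool × (Fin s → Bool)`). [folklore] -/
def idleEquiv (k s : ℕ) : (Fin k → Fin s → Bool) × (Fin k → Bool) ≃ (Fin k → Fin (s + 1) → Bool) where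
  toFun p := fun i => Fin.snoc (p.1 i) (p.2 i)
  invFun x := (fun i j => x i (Fin.castSucc j), fun i => x i (Fin.last s))
  left_inv p := by
    obtain ⟨y, b⟩ := p
    simp only [Fin.snoc_castSucc, Fin.snoc_last]
  right_inv x := by
    funext i
    exact Fin.snoc_init_self (x i)

/-- **The twisted sum factorises**: `∑ₓ w = (∑_y w') · T_k`. [cite: AaronsonAmbainis2018, §1.1.3] -/
theorem sum_pathWeight_idle (g : Fin k → (Fin s → Bool) → Bool) :
    ∑ x : Fin k → Fin (s + 1) → Bool, pathWeight (fun i x => g i (fun j => x (Fin.castSucc j))) x =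
      (∑ y : Fin k → Fin s → Bool, pathWeight g y) * twistSum k := by
  rw [← (idleEquiv k s).sum_comp, Fintype.sum_prod_type, twistSum, Finset.sum_mul_sum]
  refine Finset.sum_congr rfl fun y _ => Finset.sum_congr rfl fun b _ => ?_
  exact pathWeight_idle g y b

/-- The normalisation splits off one coordinate. [folklore] -/
theorem sqrt_two_pow_succ_mul (k s : ℕ) :
    Real.sqrt (2 ^ ((k + 1) * (s + 1))) = Real.sqrt (2 ^ ((k + 1) * s)) * Real.sqrt (2 ^ (k + 1)) := by
  rw [← Real.sqrt_mul (by positivity), ← pow_add]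
  ring_nf

/-- **One idle coordinate**: `Φ_f = Φ_g · T_k / √(2^{k+1})` when every `fᵢ` is `gᵢ` on the first
`s` coordinates and ignores the last one. [cite: AaronsonAmbainis2018, §1.1.3 and §3.2] -/
theorem kForrelationValue_idle (g : Fin k → (Fin s → Bool) → Bool) :
    kForrelationValue (n := s + 1) (fun i x => g i (fun j => x (Fin.castSucc j))) =
      kForrelationValue g * (twistSum k / Real.sqrt (2 ^ (k + 1))) := by
  rw [kForrelationValue_eq, kForrelationValue_eq, sum_pathWeight_idle, sqrt_two_pow_succ_mul]
  have h1 : Real.sqrt (2 ^ ((k + 1) * s)) ≠ 0 := by positivity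
  have h2 : Real.sqrt (2 ^ (k + 1)) ≠ 0 := by positivity
  field_simp

/-! ### The value of `T_k` -/

/-- `T_0 = 1`. [folklore] -/
theorem twistSum_zero : twistSum 0 = 1 := by
  simp [twistSum, chainWeight]

/-- `T_1 = 2`. [folklore] -/
theorem twistSum_one : twistSum 1 = 2 := by
  have h : ∀ b : Fin 1 → Bool, chainWeight b = 1 := fun b => by
    simp [chainWeight]
  simp only [twistSum, h, Finset.sum_const, Finset.card_univ, nsmul_eq_mul, mul_one]
  simp

/-- `T_2 = 2`. [folklore] -/
theorem twistSum_two : twistSum 2 = 2 := by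
  have h : ∀ b : Fin 2 → Bool, chainWeight b = signOf (b 0 && b 1) := fun b => by
    simp [chainWeight, Fin.prod_univ_two]
  simp only [twistSum, h]
  rw [← (piFinTwoEquiv fun _ => Bool).symm.sum_comp, Fintype.sum_prod_type, Fintype.sum_bool, Fintype.sum_bool,
    Fintype.sum_bool]
  simp [piFinTwoEquiv, signOf]
  norm_num

/-- Appending a bit multiplies the chain weight by the one-bit twist against the previous last bit.
[cite: AaronsonAmbainis2018, §1.1.3] -/
theorem chainWeight_snoc (b : Fin (k + 1) → Bool) (c : Bool) :
    chainWeight (Fin.snoc b c : Fin (k + 2) → Bool) = chainWeight b * signOf (b (Fin.last k) && c) := by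
  unfold chainWeight
  rw [Fin.prod_univ_castSucc]
  congr 1
  · refine Finset.prod_congr rfl fun i _ => ?_
    have hi : ((Fin.castSucc i : Fin (k + 2)) : ℕ) = (i : ℕ) := rfl
    by_cases h : (i : ℕ) = 0
    · rw [dif_pos (hi.trans h), dif_pos h]
    · rw [dif_neg (by rw [hi]; exact h), dif_neg h, Fin.snoc_castSucc]
      congr 1
      have e : (⟨(Fin.castSucc i : Fin (k + 2)) - 1, by simp; omega⟩ : Fin (k + 2)) =
          Fin.castSucc (⟨(i : ℕ) - 1, by omega⟩ : Fin (k + 1)) := Fin.ext (by simp)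
      rw [e, Fin.snoc_castSucc]
  · rw [dif_neg (by simp)]
    have e : (⟨((Fin.last (k + 1) : Fin (k + 2)) : ℕ) - 1, by simp⟩ : Fin (k + 2)) = Fin.castSucc (Fin.last k) :=
      Fin.ext (by simp)
    rw [e, Fin.snoc_castSucc, Fin.snoc_last]

/-- Summing the one-bit twist over the appended bit: `2` after a `0`, `0` after a `1`. [folklore] -/
theorem sum_signOf_and (a : Bool) : (∑ c : Bool, signOf (a && c)) = if a then 0 else 2 := by
  cases a <;> simp [signOf]

/-- **The recursion `T_{k+3} = 2 T_{k+1}`** (append two bits: the last sum kills the tuples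
ending in `1`, and appending a `0` does not change the weight). [cite: AaronsonAmbainis2018, §1.1.3] -/
theorem twistSum_add_three (k : ℕ) : twistSum (k + 3) = 2 * twistSum (k + 1) := by
  unfold twistSum
  rw [sum_tuple_succ]
  simp only [chainWeight_snoc]
  rw [Finset.sum_comm]
  simp only [← Finset.mul_sum, sum_signOf_and]
  rw [sum_tuple_succ]
  simp only [Fin.snoc_last, chainWeight_snoc]
  rw [Fintype.sum_bool]
  simp only [↓reduceIte, mul_zero, Finset.sum_const_zero, zero_add, Bool.false_eq_true, Finset.mul_sum]
  refine Finset.sum_congr rfl fun b _ => ?_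
  simp [signOf]; ring

/-- **`T_k = 2^{⌈k/2⌉}`.** [cite: AaronsonAmbainis2018, §1.1.3] -/
theorem twistSum_eq : ∀ k : ℕ, twistSum k = 2 ^ ((k + 1) / 2)
  | 0 => by rw [twistSum_zero]; norm_num
  | 1 => by rw [twistSum_one]; norm_num
  | 2 => by rw [twistSum_two]; norm_num
  | k + 3 => by
    rw [twistSum_add_three, twistSum_eq (k + 1)]
    have e : (k + 3 + 1) / 2 = (k + 1 + 1) / 2 + 1 := by omega
    rw [e, pow_succ]; ring

/-- The idle-coordinate factor `ρ_k = T_k / √(2^{k+1})`. [cite: AaronsonAmbainis2018, §3.2] -/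
def idleFactor (k : ℕ) : ℝ := twistSum k / Real.sqrt (2 ^ (k + 1))

/-- **`ρ_k = 1` for odd `k`** (an idle coordinate carries `H^{k+1} = 1`). [cite: AaronsonAmbainis2018, §3.2] -/
theorem idleFactor_of_odd (hk : k % 2 = 1) : idleFactor k = 1 := by
  unfold idleFactor
  obtain ⟨m, hm⟩ : ∃ m, k + 1 = 2 * m := ⟨(k + 1) / 2, by omega⟩
  rw [twistSum_eq, show (k + 1) / 2 = m by omega, hm, pow_mul', Real.sqrt_sq (by positivity)]
  exact div_self (by positivity)

/-- **`ρ_k = 1/√2` for even `k`** (an idle coordinate carries `H^{k+1} = H`). [cite: AaronsonAmbainis2018, §3.2] -/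
theorem idleFactor_of_even (hk : k % 2 = 0) : idleFactor k = (Real.sqrt 2)⁻¹ := by
  unfold idleFactor
  obtain ⟨m, hm⟩ : ∃ m, k + 1 = 2 * m + 1 := ⟨(k + 1) / 2, by omega⟩
  rw [twistSum_eq, show (k + 1) / 2 = m by omega, hm, pow_succ, Real.sqrt_mul (by positivity), pow_mul',
    Real.sqrt_sq (by positivity)]
  have h2 : (2 : ℝ) ^ m ≠ 0 := by positivity
  have hs : Real.sqrt 2 ≠ 0 := by positivity
  field_simp

/-- `ρ_k ≤ 1`. [folklore] -/
theorem idleFactor_le_one (k : ℕ) : idleFactor k ≤ 1 := by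
  rcases Nat.mod_two_eq_zero_or_one k with h | h
  · rw [idleFactor_of_even h]
    have : 1 ≤ Real.sqrt 2 := Real.one_le_sqrt.2 (by norm_num)
    exact inv_le_one_of_one_le₀ this
  · rw [idleFactor_of_odd h]

/-- `0 ≤ ρ_k`. [folklore] -/
theorem idleFactor_nonneg (k : ℕ) : 0 ≤ idleFactor k := by
  unfold idleFactor
  rw [twistSum_eq]
  positivity

/-! ### Several idle coordinates -/

/-- **`t` idle coordinates**: `Φ_f = Φ_g · ρ_k^t` when every `fᵢ` is `gᵢ` on the first `s`
coordinates and ignores the last `t`. [cite: AaronsonAmbainis2018, §1.1.3 and §3.2] -/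
theorem kForrelationValue_idle_pow (g : Fin k → (Fin s → Bool) → Bool) : ∀ t : ℕ,
    kForrelationValue (n := s + t) (fun i x => g i (fun j => x (Fin.castAdd t j))) = kForrelationValue g * idleFactor k ^ t
  | 0 => by simp
  | t + 1 => by
    have ih := kForrelationValue_idle_pow g t
    have step := kForrelationValue_idle (s := s + t) (fun i' x' => g i' fun j => x' (Fin.castAdd t j))
    calc kForrelationValue (n := s + (t + 1)) (fun i x => g i (fun j => x (Fin.castAdd (t + 1) j)))
        = kForrelationValue (n := s + t) (fun i' x' => g i' fun j => x' (Fin.castAdd t j)) *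
            (twistSum k / Real.sqrt (2 ^ (k + 1))) := step
      _ = kForrelationValue g * idleFactor k ^ (t + 1) := by rw [ih, idleFactor, pow_succ]; ring

/-- **Odd `k`: idle coordinates do not change `Φ`.** [cite: AaronsonAmbainis2018, §3.2] -/
theorem kForrelationValue_idle_pow_of_odd (hk : k % 2 = 1) (g : Fin k → (Fin s → Bool) → Bool) (t : ℕ) :
    kForrelationValue (n := s + t) (fun i x => g i (fun j => x (Fin.castAdd t j))) = kForrelationValue g := by
  rw [kForrelationValue_idle_pow, idleFactor_of_odd hk, one_pow, mul_one]

/-- **Even `k`: `t` idle coordinates scale `Φ` by `2^{-t/2}`**, so `|Φ| ≤ (1/√2)^t`.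
[cite: AaronsonAmbainis2018, §3.2] -/
theorem abs_kForrelationValue_idle_pow_le_of_even (hk : k % 2 = 0) (g : Fin k → (Fin s → Bool) → Bool) (t : ℕ) :
    |kForrelationValue (n := s + t) (fun i x => g i (fun j => x (Fin.castAdd t j)))| ≤ ((Real.sqrt 2)⁻¹) ^ t := by
  rw [kForrelationValue_idle_pow, idleFactor_of_even hk, abs_mul, abs_pow,
    abs_of_nonneg (inv_nonneg.2 (Real.sqrt_nonneg 2))]
  have h1 := abs_kForrelationValue_le_one g
  have h2 : 0 ≤ ((Real.sqrt 2)⁻¹) ^ t := by positivity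
  calc |kForrelationValue g| * ((Real.sqrt 2)⁻¹) ^ t ≤ 1 * ((Real.sqrt 2)⁻¹) ^ t := mul_le_mul_of_nonneg_right h1 h2
    _ = ((Real.sqrt 2)⁻¹) ^ t := one_mul _

end Literature.Computability.QuantumComplexity

end
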